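import Literature.MathematicalPhysics.QuantumFieldTheory.QCDOS
import Literature.MathematicalPhysics.QuantumFieldTheory.DiagonalLatticeClustering
import Literature.MathematicalPhysics.QuantumFieldTheory.OSReconstructionNoE1
import Literature.MathematicalPhysics.QuantumFieldTheory.QCDAsymptoticScalingCouplingDivergence
import Summits.QuantumFields.YangMills.Theorems.ParabolicTrajectoryContinuumLimitOnTrajectoryStubOSLegsC_Hermitian
import Summits.QuantumFields.QCD.Theorems.QuarksAsStableActionStableActionBridgeDefs
import HarnessLib

/-!
# Reshape proposal for stub `stub_reflectionAxioms` (crux stmt-QuantumFields-11525 `ConvergentOSClosure`, line birth)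

Worker analysis file (NOT a tree file; no `sorry`; every signature below elaborates).  See the companion
`stub_reflectionAxioms-analysis.md`.  Contents:

* §0 `reflectionAxioms_of_rp_cluster` — E0-hermiticity is NOT an independent conjunct: E2 + E0-normalisation ⇒
  hermiticity (tree theorem `osLegsC_isHermitian_of_isReflectionPositive`, KQR Rem. 2.2), so the stub is
  equivalent to `S.IsReflectionPositive ∧ S.HasClusterProperty`.
* §1 the two lattice-side predicates in TENSOR currency that DO transfer to a labelled limit pinned only on
  off-diagonal real product tensors (parallel to the tree's `ClustersCS` / `ClustersDiag`):
  `PositiveCS d Λ` (eventual approximate OS positivity of the Gram forms of `Λ k` on slab-ordered real product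
  data, explicit vacuum coefficient) and `ClustersSpatially d Λ` (k-UNIFORM spatial clustering, rate-free,
  `t₀` chosen before `∀ᶠ k`).
  `positiveCS_of_tendsto_sub` (PROVED): `PositiveCS` passes along lattice approximations that agree asymptotically on
  off-diagonal real product tensors.
* §2 the five proposed replacement stubs as `Prop`s (S2a–S2e), the proved glue `positiveCS_of_comparison`, and the
  kernel-checked recomposition `stub_reflectionAxioms_of_reshape` of the registered signature (for `N_f ≤ 16`).
-/

noncomputable section

namespace Summit.QuantumFields.QCD.Theorems.ConvergentOSClosure

open scoped BigOperators Topology SchwartzMap ComplexConjugate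
open MeasureTheory Filter
open Literature.MathematicalPhysics.AQFT Literature.MathematicalPhysics.QuantumLattice
  Literature.MathematicalPhysics.QuantumFieldTheory
open Summit.QuantumFields.QCD.Cruxes.StableActionBridge.Sketch (qcdLatticeSchwingerSymAP)

local notation "E4" => EuclideanSpace ℝ (Fin 4)

/-! ## §0 Hermiticity is a consequence of E2 + E0-normalisation -/

/-- The registered stub follows from its E2 and E4 conjuncts alone (hermiticity by KQR Rem. 2.2, tree theorem
`osLegsC_isHermitian_of_isReflectionPositive`). -/
theorem reflectionAxioms_of_rp_cluster {Nf : ℕ} (S : LabelledSchwingerFamily (QCDField Nf) E4)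
    (hN : S.IsNormalized) (hRP : S.IsReflectionPositive) (hCl : S.HasClusterProperty) :
    S.IsHermitian ∧ S.IsReflectionPositive ∧ S.HasClusterProperty :=
  ⟨Summit.QuantumFields.YangMills.Cruxes.ContinuumLimitOnTrajectory.TwoOrbitSynchronisation.osLegsC_isHermitian_of_isReflectionPositive
      S hRP hN, hRP, hCl⟩

/-! ## §1 Lattice-side predicates in tensor currency -/

section Generic

variable (d : ℕ) [NeZero d] {ι : Type}

/-- **Eventual approximate OS positivity of a lattice approximation on slab-ordered real product data.**
For every finite family of slots `j` (arity `deg j ≥ 1`, label string `lab j`, slab-ordered real factor data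
`p j`, coefficient `c j`), every vacuum coefficient `c₀` and every `ε > 0`, EVENTUALLY in `k` the Gram form
`z = |c₀|² + Σⱼ (c̄₀ cⱼ Λᵏ(pⱼ) + c̄ⱼ c₀ Λᵏ(θpⱼʳ)) + Σᵢⱼ c̄ᵢ cⱼ Λᵏ_{degᵢ+degⱼ}(θpᵢʳ ++ pⱼ)` has `re z ≥ −ε` and
`|im z| ≤ ε`.  (On the lattice this is `⟨(c₀ + X) · Θ(c₀ + X)⟩ ≥ 0` for the smeared observable `X`, up to a
boundary-condition / density-symmetrisation defect vanishing as `k → ∞`.)  The RP twin of `ClustersCS`. -/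
def PositiveCS (Λ : ℕ → (n : ℕ) → (Fin n → ι) → (Fin n → 𝓢(EuclideanSpace ℝ (Fin d), ℝ)) → ℂ) : Prop :=
  ∀ (N : ℕ) (deg : Fin N → ℕ), (∀ j, deg j ≠ 0) → ∀ (lab : (j : Fin N) → Fin (deg j) → ι) (c₀ : ℂ)
    (c : Fin N → ℂ) (p : (j : Fin N) → Fin (deg j) → 𝓢(EuclideanSpace ℝ (Fin d), ℝ)),
    (∀ j, IsSlabOrdered (p j)) → ∀ ε : ℝ, 0 < ε → ∀ᶠ k in atTop,
      -ε ≤ (conj c₀ * c₀ +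
            ∑ j, (conj c₀ * c j * Λ k (deg j) (lab j) (p j) +
              conj (c j) * c₀ * Λ k (deg j) (lab j ∘ Fin.rev) (fun l => thetaTest d (p j (Fin.rev l)))) +
            ∑ i, ∑ j, conj (c i) * c j *
              Λ k (deg i + deg j) (Fin.append (lab i ∘ Fin.rev) (lab j))
                (Fin.append (fun l => thetaTest d (p i (Fin.rev l))) (p j))).re ∧
      |(conj c₀ * c₀ +
            ∑ j, (conj c₀ * c j * Λ k (deg j) (lab j) (p j) +
              conj (c j) * c₀ * Λ k (deg j) (lab j ∘ Fin.rev) (fun l => thetaTest d (p j (Fin.rev l)))) +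
            ∑ i, ∑ j, conj (c i) * c j *
              Λ k (deg i + deg j) (Fin.append (lab i ∘ Fin.rev) (lab j))
                (Fin.append (fun l => thetaTest d (p i (Fin.rev l))) (p j))).im| ≤ ε

/-- **k-uniform spatial clustering of a lattice approximation on slab-ordered real product data** (rate-free;
the E4 twin of `ClustersDiag`): for `n, m ≥ 1`, label strings, slab-ordered data `p, q`, a purely spatial
`a ≠ 0` and `ε > 0` there is `t₀` such that for every `t ≥ t₀`, EVENTUALLY in `k`,
`‖Λᵏ_{n+m}(θpʳ ++ T_{ta} q) − Λᵏₙ(θpʳ) Λᵏₘ(q)‖ ≤ ε`.  The order `∃ t₀ … ∀ᶠ k` is the k-uniformity that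
per-pair lattice gap constants (`HasLatticeMassGap`) do not supply. -/
def ClustersSpatially (Λ : ℕ → (n : ℕ) → (Fin n → ι) → (Fin n → 𝓢(EuclideanSpace ℝ (Fin d), ℝ)) → ℂ) : Prop :=
  ∀ (n m : ℕ), n ≠ 0 → m ≠ 0 → ∀ (σ : Fin n → ι) (σ' : Fin m → ι)
    (p : Fin n → 𝓢(EuclideanSpace ℝ (Fin d), ℝ)) (q : Fin m → 𝓢(EuclideanSpace ℝ (Fin d), ℝ)),
    IsSlabOrdered p → IsSlabOrdered q → ∀ a : EuclideanSpace ℝ (Fin d), a 0 = 0 → a ≠ 0 →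
    ∀ ε : ℝ, 0 < ε → ∃ t₀ : ℝ, ∀ t : ℝ, t₀ ≤ t → ∀ᶠ k in atTop,
      ‖Λ k (n + m) (Fin.append (σ ∘ Fin.rev) σ')
          (Fin.append (fun l => thetaTest d (p (Fin.rev l))) (fun l => translateTest (t • a) (q l))) -
        Λ k n (σ ∘ Fin.rev) (fun l => thetaTest d (p (Fin.rev l))) * Λ k m σ' q‖ ≤ ε

/-- **`PositiveCS` passes along asymptotically equal lattice approximations** (PROVED): if `Λ' k − Λ k → 0` on every
off-diagonal real product tensor of arity `n ≥ 1` and `Λ'` is `PositiveCS`, so is `Λ` — every lattice value in the Gram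
form is read on an off-diagonal real product tensor (`pⱼ`, `θpⱼʳ = Θ(⊗pⱼ)*`, `θpᵢʳ ++ pⱼ = Θ(⊗pᵢ)* ⊗ (⊗pⱼ)`), the finite
sums of differences are eventually `< ε/2` in norm, and `|re w|, |im w| ≤ ‖w‖`. -/
theorem positiveCS_of_tendsto_sub
    (Λ Λ' : ℕ → (n : ℕ) → (Fin n → ι) → (Fin n → 𝓢(EuclideanSpace ℝ (Fin d), ℝ)) → ℂ)
    (h : ∀ n : ℕ, n ≠ 0 → ∀ (σ : Fin n → ι) (f : Fin n → 𝓢(EuclideanSpace ℝ (Fin d), ℝ))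
      (F : 𝓢((Fin n → EuclideanSpace ℝ (Fin d)), ℂ)), IsTensorOf F (fun i => ofRealTest (f i)) → IsOffDiagonal F →
        Tendsto (fun k => Λ' k n σ f - Λ k n σ f) atTop (nhds 0))
    (hP : PositiveCS d Λ') : PositiveCS d Λ := by
  intro N deg hdeg lab c₀ c p hp ε hε
  -- tensor witnesses of the slab-ordered data and their time-orderedness
  have hPex : ∀ j, ∃ P : 𝓢((Fin (deg j) → EuclideanSpace ℝ (Fin d)), ℂ),
      IsTensorOf P (fun l => ofRealTest (p j l)) := fun j => exists_isTensorOf _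
  choose P hPt using hPex
  have hPo : ∀ j, IsTimeOrdered (P j) := fun j =>
    IsTimeOrdered.of_mem_slabOrderedProducts ((hp j).mem_slabOrderedProducts (hPt j))
  -- the three kinds of lattice values converge to each other
  have h1 : ∀ j, Tendsto (fun k => Λ' k (deg j) (lab j) (p j) - Λ k (deg j) (lab j) (p j)) atTop (nhds 0) :=
    fun j => h (deg j) (hdeg j) (lab j) (p j) (P j) (hPt j) (hPo j).isOffDiagonal
  have h2 : ∀ j, Tendsto (fun k => Λ' k (deg j) (lab j ∘ Fin.rev) (fun l => thetaTest d (p j (Fin.rev l))) -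
      Λ k (deg j) (lab j ∘ Fin.rev) (fun l => thetaTest d (p j (Fin.rev l)))) atTop (nhds 0) :=
    fun j => h (deg j) (hdeg j) _ _ (osAdjoint (P j)) (hPt j).osAdjoint (hPo j).isOffDiagonal.osAdjoint
  have h3 : ∀ i j, Tendsto (fun k =>
      Λ' k (deg i + deg j) (Fin.append (lab i ∘ Fin.rev) (lab j))
          (Fin.append (fun l => thetaTest d (p i (Fin.rev l))) (p j)) -
        Λ k (deg i + deg j) (Fin.append (lab i ∘ Fin.rev) (lab j))
          (Fin.append (fun l => thetaTest d (p i (Fin.rev l))) (p j))) atTop (nhds 0) := by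
    intro i j
    have hne : deg i + deg j ≠ 0 := by have := hdeg i; omega
    refine h (deg i + deg j) hne _ _ ((osAdjoint (P i)).appendTensor (P j)) ?_ ?_
    · have h0 := (hPt i).osAdjoint.appendTensor (hPt j)
      rwa [append_ofRealTest] at h0
    · exact OSReconstructionNoE1.isOffDiagonal_appendTensor_osAdjoint (hPo i) (hPo j)
  -- the difference of the two Gram forms tends to zero
  set z : ℕ → ℂ := fun k => conj c₀ * c₀ +
      ∑ j, (conj c₀ * c j * Λ k (deg j) (lab j) (p j) +
        conj (c j) * c₀ * Λ k (deg j) (lab j ∘ Fin.rev) (fun l => thetaTest d (p j (Fin.rev l)))) +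
      ∑ i, ∑ j, conj (c i) * c j *
        Λ k (deg i + deg j) (Fin.append (lab i ∘ Fin.rev) (lab j))
          (Fin.append (fun l => thetaTest d (p i (Fin.rev l))) (p j)) with hz
  set z' : ℕ → ℂ := fun k => conj c₀ * c₀ +
      ∑ j, (conj c₀ * c j * Λ' k (deg j) (lab j) (p j) +
        conj (c j) * c₀ * Λ' k (deg j) (lab j ∘ Fin.rev) (fun l => thetaTest d (p j (Fin.rev l)))) +
      ∑ i, ∑ j, conj (c i) * c j *
        Λ' k (deg i + deg j) (Fin.append (lab i ∘ Fin.rev) (lab j))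
          (Fin.append (fun l => thetaTest d (p i (Fin.rev l))) (p j)) with hz'
  have hdiff : Tendsto (fun k => z' k - z k) atTop (nhds 0) := by
    have hs1 : Tendsto (fun k => ∑ j, (conj c₀ * c j * (Λ' k (deg j) (lab j) (p j) - Λ k (deg j) (lab j) (p j)) +
        conj (c j) * c₀ * (Λ' k (deg j) (lab j ∘ Fin.rev) (fun l => thetaTest d (p j (Fin.rev l))) -
          Λ k (deg j) (lab j ∘ Fin.rev) (fun l => thetaTest d (p j (Fin.rev l)))))) atTop (nhds 0) := by
      have := tendsto_finsetSum (Finset.univ : Finset (Fin N)) fun j _ =>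
        ((h1 j).const_mul (conj c₀ * c j)).add ((h2 j).const_mul (conj (c j) * c₀))
      simpa using this
    have hs2 : Tendsto (fun k => ∑ i, ∑ j, conj (c i) * c j *
        (Λ' k (deg i + deg j) (Fin.append (lab i ∘ Fin.rev) (lab j))
            (Fin.append (fun l => thetaTest d (p i (Fin.rev l))) (p j)) -
          Λ k (deg i + deg j) (Fin.append (lab i ∘ Fin.rev) (lab j))
            (Fin.append (fun l => thetaTest d (p i (Fin.rev l))) (p j)))) atTop (nhds 0) := by
      have := tendsto_finsetSum (Finset.univ : Finset (Fin N)) fun i _ =>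
        tendsto_finsetSum (Finset.univ : Finset (Fin N)) fun j _ => (h3 i j).const_mul (conj (c i) * c j)
      simpa using this
    have hsum := hs1.add hs2
    rw [add_zero] at hsum
    refine hsum.congr' (Eventually.of_forall fun k => ?_)
    symm
    simp only [hz, hz']
    rw [show ∀ (a b e f g : ℂ), (a + b + e) - (a + f + g) = (b - f) + (e - g) from fun _ _ _ _ _ => by ring,
      ← Finset.sum_sub_distrib, ← Finset.sum_sub_distrib]
    congr 1
    · exact Finset.sum_congr rfl fun j _ => by ring
    · refine Finset.sum_congr rfl fun i _ => ?_
      rw [← Finset.sum_sub_distrib]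
      exact Finset.sum_congr rfl fun j _ => by ring
  have hsmall : ∀ᶠ k in atTop, ‖z' k - z k‖ < ε / 2 := by
    have := hdiff.norm
    rw [norm_zero] at this
    exact this.eventually (gt_mem_nhds (half_pos hε))
  filter_upwards [hP N deg hdeg lab c₀ c p hp (ε / 2) (half_pos hε), hsmall] with k hk hk'
  have hre : |(z' k - z k).re| ≤ ‖z' k - z k‖ := Complex.abs_re_le_norm _
  have him : |(z' k - z k).im| ≤ ‖z' k - z k‖ := Complex.abs_im_le_norm _
  rw [Complex.sub_re] at hre
  rw [Complex.sub_im] at him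
  change -(ε / 2) ≤ (z' k).re ∧ |(z' k).im| ≤ ε / 2 at hk
  change -ε ≤ (z k).re ∧ |(z k).im| ≤ ε
  obtain ⟨hk1, hk2⟩ := hk
  constructor
  · have := (abs_le.1 hre).2
    linarith
  · rw [abs_le] at hk2 him ⊢
    constructor <;> linarith [hk2.1, hk2.2, him.1, him.2]

end Generic

/-! ## §2 The proposed replacement stubs (as `Prop`s) and the recomposition -/

section Reshape

/-- The limit clause of the registered stub (abbreviation used below). -/
def IsTensorLimit {Nf : ℕ} (sch : QCDScheme Nf) (S : LabelledSchwingerFamily (QCDField Nf) E4) : Prop :=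
  ∀ n : ℕ, n ≠ 0 → ∀ (σ : Fin n → QCDField Nf) (f : Fin n → 𝓢(E4, ℝ)) (F : 𝓢((Fin n → E4), ℂ)),
    IsTensorOf F (fun i => ofRealTest (f i)) → IsOffDiagonal F →
      Tendsto (fun k : ℕ => qcdLatticeSchwinger sch k n σ f) atTop (nhds (S n σ F))

/-- **S2a (OPEN, lattice; the physics): the thermal/Θ-symmetrised functional agrees with the statement's own-torus
functional in the limit** — clause P12′ of `SymThermalLatticePackage` (crux 9737, r3e) under this crux's hypotheses:
time-PERIODIC vs ANTIPERIODIC quarks at the scheme's own volume `(2L_k+1) a_k → ∞` (thermal smallness from the gap)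
and FORWARD vs time-symmetrised action density (`O(a_k)` chirality defect, `actionDensity_cfgReflect`) are invisible
on off-diagonal real tensors as `k → ∞`. -/
def SpeciesComparisonStmt : Prop :=
  ∀ (Nf : ℕ) (sch : QCDScheme Nf), sch.HasAsymptoticScaling → (∀ fl : Fin Nf, ∀ᶠ k in atTop, -1 < sch.mq fl k) →
    (∃ Δ > 0, sch.HasLatticeMassGap Δ) →
    (∀ n : ℕ, n ≠ 0 → ∀ (σ : Fin n → QCDField Nf) (f : Fin n → 𝓢(E4, ℝ)) (F : 𝓢((Fin n → E4), ℂ)),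
      IsTensorOf F (fun i => ofRealTest (f i)) → IsOffDiagonal F →
        ∃ c : ℂ, Tendsto (fun k : ℕ => qcdLatticeSchwinger sch k n σ f) atTop (nhds c)) →
    ∀ n : ℕ, n ≠ 0 → ∀ (σ : Fin n → QCDField Nf) (f : Fin n → 𝓢(E4, ℝ)) (F : 𝓢((Fin n → E4), ℂ)),
      IsTensorOf F (fun i => ofRealTest (f i)) → IsOffDiagonal F →
        Tendsto (fun k => qcdLatticeSchwingerSymAP sch k n σ f - qcdLatticeSchwinger sch k n σ f) atTop (nhds 0)

/-- **S2b (provable soon, lattice, EXACT RP): the thermal Θ-symmetrised functional is `PositiveCS`** along every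
scheme with `β_k ≥ 0` eventually (⇐ asymptotic scaling for `N_f ≤ 16`, `eventually_le_beta_of_hasAsymptoticScaling`)
and bare masses eventually on the branch: slab supports `[lo, hi] ⊂ (0, ∞)` sit at lattice times `2 ≤ t ≤ L_k − 1`
eventually (`a_k → 0`, `a_k L_k → ∞`), where `stub_symAP_pairing_nonneg` (landed) gives exact positivity of the thermal
pairing and `stub_symAP_osForm_eq_pairing` (registered in 9737's skeleton, unlanded, needs `Z_AP(k) ≠ 0`) identifies it
with the Gram form. -/
def SymAPPositiveCSStmt : Prop :=
  ∀ (Nf : ℕ) (sch : QCDScheme Nf), (∀ᶠ k in atTop, 0 ≤ sch.β k) → (∀ fl : Fin Nf, ∀ᶠ k in atTop, -1 < sch.mq fl k) →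
    PositiveCS 4 (qcdLatticeSchwingerSymAP sch)

/-- **S2c (provable now, continuum): `PositiveCS` transfers to E2 of a normalised tensor limit** — termwise limits on
slab-ordered real product data (`IsTensorOf.osAdjoint/appendTensor`, `append_ofRealTest`,
`isOffDiagonal_appendTensor_osAdjoint`), sesquilinear expansion on the spans, ordered-wedge density
`IsTimeOrdered.mem_closure_span_slabOrderedProducts` + `closure_pi_set` + joint continuity of `(F, G) ↦ 𝔖(ΘF* ⊗ G)`
(model: `SchwingerOSPositivity` §E2), degree-`0` slots through `IsNormalized`. -/
def PositiveCSTransferStmt : Prop :=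
  ∀ (Nf : ℕ) (sch : QCDScheme Nf) (S : LabelledSchwingerFamily (QCDField Nf) E4),
    S.IsNormalized → IsTensorLimit sch S → PositiveCS 4 (qcdLatticeSchwinger sch) → S.IsReflectionPositive

/-- **S2d (OPEN, lattice; the QCD twin of `GapToContinuum` D2/D3): k-uniform spatial clustering of the own-torus
functional** from the uniform lattice gap (time decay for fixed local pairs ⇒ spatial decay by the axis covariance
`qcdTorusExpect_quarkAxisPerm`; the k-uniformity over the k-dependent smeared observables is the missing finite-size /
pair-uniform input). -/
def SpatialClusteringStmt : Prop :=
  ∀ (Nf : ℕ) (sch : QCDScheme Nf), sch.HasAsymptoticScaling → (∀ fl : Fin Nf, ∀ᶠ k in atTop, -1 < sch.mq fl k) →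
    (∃ Δ > 0, sch.HasLatticeMassGap Δ) →
    (∀ n : ℕ, n ≠ 0 → ∀ (σ : Fin n → QCDField Nf) (f : Fin n → 𝓢(E4, ℝ)) (F : 𝓢((Fin n → E4), ℂ)),
      IsTensorOf F (fun i => ofRealTest (f i)) → IsOffDiagonal F →
        ∃ c : ℂ, Tendsto (fun k : ℕ => qcdLatticeSchwinger sch k n σ f) atTop (nhds c)) →
    ClustersSpatially 4 (qcdLatticeSchwinger sch)

/-- **S2e (provable now, continuum): `ClustersSpatially` transfers to E4 of a normalised, translation-invariant,
reflection-positive tensor limit** — termwise limits on slab-ordered data, finite sums on the spans, and the passage to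
all time-ordered `F, G` by the `t`-UNIFORM continuity `|𝔖(Θ(F−F')* ⊗ T_{ta}G)| ≤ ‖Ψ_{F−F'}‖ ‖Ψ_G‖` (unitarity of the
spatial translations on the OS space, `OSReconstructionNoE1.translate`) + ordered-wedge density; degree `0` by
translation invariance and `IsNormalized`. -/
def ClusterTransferStmt : Prop :=
  ∀ (Nf : ℕ) (sch : QCDScheme Nf) (S : LabelledSchwingerFamily (QCDField Nf) E4),
    S.IsNormalized → S.IsTranslationInvariant → S.IsReflectionPositive → IsTensorLimit sch S →
    ClustersSpatially 4 (qcdLatticeSchwinger sch) → S.HasClusterProperty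

/-- **Glue (PROVED): `PositiveCS` of the thermal Θ-symmetrised functional + the comparison S2a ⇒ `PositiveCS` of the
statement's own-torus functional** (`positiveCS_of_tendsto_sub`). -/
theorem positiveCS_of_comparison {Nf : ℕ} (sch : QCDScheme Nf)
    (hcmp : ∀ n : ℕ, n ≠ 0 → ∀ (σ : Fin n → QCDField Nf) (f : Fin n → 𝓢(E4, ℝ)) (F : 𝓢((Fin n → E4), ℂ)),
      IsTensorOf F (fun i => ofRealTest (f i)) → IsOffDiagonal F →
        Tendsto (fun k => qcdLatticeSchwingerSymAP sch k n σ f - qcdLatticeSchwinger sch k n σ f) atTop (nhds 0))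
    (hP : PositiveCS 4 (qcdLatticeSchwingerSymAP sch)) : PositiveCS 4 (qcdLatticeSchwinger sch) :=
  positiveCS_of_tendsto_sub 4 (qcdLatticeSchwinger sch) (qcdLatticeSchwingerSymAP sch) hcmp hP

/-- **Recomposition (kernel-checked): the registered signature of `stub_reflectionAxioms` from S2a–S2e**,
restricted to `N_f ≤ 16` where asymptotic scaling forces `β_k → +∞` (for `N_f ≥ 17`, `β_k → −∞` and no reflection
positivity is available on the lattice). -/
theorem stub_reflectionAxioms_of_reshape (hA : SpeciesComparisonStmt) (hB : SymAPPositiveCSStmt)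
    (hC : PositiveCSTransferStmt) (hD : SpatialClusteringStmt) (hE : ClusterTransferStmt) :
    ∀ (Nf : ℕ), Nf ≤ 16 → ∀ (sch : QCDScheme Nf), sch.HasAsymptoticScaling →
    (∀ fl : Fin Nf, ∀ᶠ k in Filter.atTop, -1 < sch.mq fl k) →
    (∃ Δ > 0, sch.HasLatticeMassGap Δ) →
    ∀ S : LabelledSchwingerFamily (QCDField Nf) (EuclideanSpace ℝ (Fin 4)),
      S.IsNormalized → S.HasLinearGrowth → S.IsTranslationInvariant →
      (∀ n : ℕ, n ≠ 0 → ∀ (σ : Fin n → QCDField Nf)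
        (f : Fin n → SchwartzMap (EuclideanSpace ℝ (Fin 4)) ℝ)
        (F : SchwartzMap (Fin n → EuclideanSpace ℝ (Fin 4)) ℂ),
        IsTensorOf F (fun i => ofRealTest (f i)) → IsOffDiagonal F →
          Filter.Tendsto (fun k : ℕ => qcdLatticeSchwinger sch k n σ f)
            Filter.atTop (nhds (S n σ F))) →
      S.IsHermitian ∧ S.IsReflectionPositive ∧ S.HasClusterProperty := by
  intro Nf hNf sch hAS hbr hgap S hN _hLG hTr hLim
  have hconv : ∀ n : ℕ, n ≠ 0 → ∀ (σ : Fin n → QCDField Nf) (f : Fin n → 𝓢(E4, ℝ))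
      (F : 𝓢((Fin n → E4), ℂ)), IsTensorOf F (fun i => ofRealTest (f i)) → IsOffDiagonal F →
        ∃ c : ℂ, Tendsto (fun k : ℕ => qcdLatticeSchwinger sch k n σ f) atTop (nhds c) :=
    fun n hn σ f F hF hoff => ⟨_, hLim n hn σ f F hF hoff⟩
  have hβ : ∀ᶠ k in atTop, 0 ≤ sch.β k := QCDScheme.eventually_le_beta_of_hasAsymptoticScaling hNf sch hAS 0
  have hPos : PositiveCS 4 (qcdLatticeSchwinger sch) :=
    positiveCS_of_comparison sch (hA Nf sch hAS hbr hgap hconv) (hB Nf sch hβ hbr)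
  have hRP : S.IsReflectionPositive := hC Nf sch S hN hLim hPos
  have hCl : S.HasClusterProperty := hE Nf sch S hN hTr hRP hLim (hD Nf sch hAS hbr hgap hconv)
  exact reflectionAxioms_of_rp_cluster S hN hRP hCl

end Reshape

end Summit.QuantumFields.QCD.Theorems.ConvergentOSClosure

end
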